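import Summits.BirchSwinnertonDyer.BirchSwinnertonDyer.Theorems.AlignedTransportAtTwoMainConjectureOfRankZeroBSDAtTwoSexticNormRelationDescentSeeds
import Summits.BirchSwinnertonDyer.BirchSwinnertonDyer.Theorems.AlignedTransportAtTwoMainConjectureOfRankZeroBSDAtTwoCubicChevalleyRowN3371ClassNumber
import Summits.BirchSwinnertonDyer.BirchSwinnertonDyer.Theorems.AlignedTransportAtTwoMainConjectureOfRankZeroBSDAtTwoCubicChevalleyRowN3547ClassNumber
import Summits.BirchSwinnertonDyer.BirchSwinnertonDyer.Theorems.AlignedTransportAtTwoMainConjectureOfRankZeroBSDAtTwoCubicChevalleyRowN1763ClassNumber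
import Summits.BirchSwinnertonDyer.BirchSwinnertonDyer.Theorems.AlignedTransportAtTwoMainConjectureOfRankZeroBSDAtTwoCubicChevalleyRowN2515ClassNumber
import Summits.BirchSwinnertonDyer.BirchSwinnertonDyer.Theorems.AlignedTransportAtTwoMainConjectureOfRankZeroBSDAtTwoCubicChevalleyRowN3115ClassNumber
import Summits.BirchSwinnertonDyer.BirchSwinnertonDyer.Theorems.AlignedTransportAtTwoMainConjectureOfRankZeroBSDAtTwoCubicChevalleyRowN4771ClassNumber
import Summits.BirchSwinnertonDyer.BirchSwinnertonDyer.Theorems.AlignedTransportAtTwoMainConjectureOfRankZeroBSDAtTwoCubicChevalleyRowN4883ClassNumber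
import HarnessLib

/-!
# Route `AlignedTransportAtTwo`, crux C2 `MainConjectureOfRankZeroBSDAtTwo` (stmt-BirchSwinnertonDyer-22298):
# THE `S₃` NORM-RELATION DESCENT AT `p = 2`, part 4 — SEXTIC ROWS II: the seven remaining odd-branch seeds
# (`3371`, `3547`: `2 ∤ h(ℚ(W[2])_n)` for every `n`; `1763`, `2515`, `3115`, `4771`, `4883`: `μ₂(ℚ(W[2])^{cyc}) = 0`), UNCONDITIONAL

Sequel of `…SexticNormRelationDescent{,Mu,Seeds}` (seat bsd-line-att-p4 g28; this file: the successor seat bsd-line-att-p4 g29). HONEST FRAMING: WIDTH-5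
attached prover seat on line `birth` of the lead `bsd-line-att-p2`; `--supports` stmt-BirchSwinnertonDyer-22298, closes nothing; BSD is NOT proved; crux C2,
its verdict «blocked-on `Rank1Residual.GreenbergMuConjectureIrreducible`» and every registered stub untouched. THEOREMS ONLY; instance bookkeeping.

WHAT. The odd-branch sub-cell `{Δ_min ≡ 5 (8)} ∩ {odd L/Ω} ∩ {σ₁(η) ≡ 3 (8)}` of the cubic Chevalley road has nine firing seeds with `N < 5000`
(`139a1`, `307b1`, `N1763`, `N2515`, `N3115`, `N3371`, `N3547`, `N4771`, `N4883`); part 3 did the sextic rows of `307b1` and `139a1`. Here the other seven,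
each fed ONLY with tree theorems: g27/g28's `classNumberPExp_cubicField_n<N>_eq_zero` / `classicalMuVanishes_cubicField_n<N>` (`h(ℚ(β)) = 1` kernel +
Chevalley + Fukuda, at each of the three roots `β_j`) and att-p3 g30's resolvent theorems `classGroupPRank_resolvent_eq_sum` / `classicalLambda_resolvent_le`
(genus theory in `ℚ_n`; Ferrero–Kida upper half).

* §1 `d = 3371`, `3547` PRIME `≡ 3 (mod 8)`: the resolvent tower `ℚ(√−d)^{cyc}` has `rank₂ Cl = 2^{min(n,0)} − 1 = 0`, so `e_n = 0` there, and part 2's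
  class-number form gives ★★★ `classNumberPExp_divisionField_two_n<N>_eq_zero`: `2 ∤ h(ℚ(W[2])_n)` for EVERY `n` and EVERY cyclotomic `ℤ₂`-extension
  of the `S₃`-sextic (`λ₂ = μ₂ = ν₂ = 0`), plus `classicalMuVanishes_divisionField_two_n<N>`.
* §2 `d = 1763 = 41·43`, `2515 = 5·503`, `3115 = 5·7·89`, `4771 = 13·367`, `4883 = 19·257` COMPOSITE: the resolvent has `rank₂ Cl(ℚ(√−d)_n) ≥ 1`
  (`e_n ≠ 0`; e.g. `λ₂(ℚ(√−4883)) = 64`), so only the `μ`-form applies: `classicalMuVanishes_resolvent_n<N>` (att-p3 g30, unconditional) and ★★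
  `classicalMuVanishes_divisionField_two_n<N>`: `μ₂ = 0` for EVERY cyclotomic `ℤ₂`-extension of `ℚ(W[2])`, UNCONDITIONAL.

So on the whole odd-branch census below `5000` the `S₃`-sextic `ℚ(W[2])` — Lim's natural carrier (`E[2] ⊆ E(T)`), the middle field of the registered stub
PFμ⁺ — has Iwasawa `μ₂ = 0` as a KERNEL theorem (no Iwasawa 1973, no Ferrero–Washington, no class-group computation in degree `6·2ⁿ`). Nothing closed.

References: [BiasseEtAl2022] Prop. 3.7; [Washington1997] §10.1, §13.1; [Ferrero1980AJM] §2; [Fukuda1994] Thm. 1; [RaySujatha2021] §1; tree: parts 1–3,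
`…CubicChevalleyRowN<N>ClassNumber` (att-p4 g28), `…ResolventTowerGenusStable` (att-p3 g30).
-/

set_option linter.dupNamespace false
set_option autoImplicit false

noncomputable section

open scoped Classical NumberField

namespace Summit.BirchSwinnertonDyer.BirchSwinnertonDyer.Theorems.AlignedTransportAtTwoSexticNormRelationDescentSeedsB

open NumberField Polynomial WeierstrassCurve IntermediateField Field
  Literature.NumberTheory.EllipticCurves Literature.NumberTheory.EllipticCurves.Greenberg1999
  Literature.NumberTheory.EllipticCurves.DokchitserDokchitser2012
  Literature.NumberTheory.EllipticCurves.ZpExtension Literature.NumberTheory.GaloisRepresentations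
  Literature.NumberTheory.IwasawaTheory Literature.NumberTheory.NumberFields
  Summit.BirchSwinnertonDyer.BirchSwinnertonDyer.Theorems.AlignedTransportAtTwoFineRoad.DivisionCubic
  Summit.BirchSwinnertonDyer.BirchSwinnertonDyer.Theorems.AlignedTransportAtTwoSexticNormRelationDescent
  Summit.BirchSwinnertonDyer.BirchSwinnertonDyer.Theorems.AlignedTransportAtTwoSexticNormRelationDescentMu
  Summit.BirchSwinnertonDyer.BirchSwinnertonDyer.Theorems.AlignedTransportAtTwoSexticNormRelationDescentSeeds
  Summit.BirchSwinnertonDyer.BirchSwinnertonDyer.Theorems.AlignedTransportAtTwoResolventTowerGenusStable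
  Summit.BirchSwinnertonDyer.BirchSwinnertonDyer.Theorems.AlignedTransportAtTwoCubicChevalleyRowN3371
  Summit.BirchSwinnertonDyer.BirchSwinnertonDyer.Theorems.AlignedTransportAtTwoCubicChevalleyRowN3371ClassNumber
  Summit.BirchSwinnertonDyer.BirchSwinnertonDyer.Theorems.AlignedTransportAtTwoCubicChevalleyRowN3547
  Summit.BirchSwinnertonDyer.BirchSwinnertonDyer.Theorems.AlignedTransportAtTwoCubicChevalleyRowN3547ClassNumber
  Summit.BirchSwinnertonDyer.BirchSwinnertonDyer.Theorems.AlignedTransportAtTwoCubicChevalleyRowN1763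
  Summit.BirchSwinnertonDyer.BirchSwinnertonDyer.Theorems.AlignedTransportAtTwoCubicChevalleyRowN1763ClassNumber
  Summit.BirchSwinnertonDyer.BirchSwinnertonDyer.Theorems.AlignedTransportAtTwoCubicChevalleyRowN2515
  Summit.BirchSwinnertonDyer.BirchSwinnertonDyer.Theorems.AlignedTransportAtTwoCubicChevalleyRowN2515ClassNumber
  Summit.BirchSwinnertonDyer.BirchSwinnertonDyer.Theorems.AlignedTransportAtTwoCubicChevalleyRowN3115
  Summit.BirchSwinnertonDyer.BirchSwinnertonDyer.Theorems.AlignedTransportAtTwoCubicChevalleyRowN3115ClassNumber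
  Summit.BirchSwinnertonDyer.BirchSwinnertonDyer.Theorems.AlignedTransportAtTwoCubicChevalleyRowN4771
  Summit.BirchSwinnertonDyer.BirchSwinnertonDyer.Theorems.AlignedTransportAtTwoCubicChevalleyRowN4771ClassNumber
  Summit.BirchSwinnertonDyer.BirchSwinnertonDyer.Theorems.AlignedTransportAtTwoCubicChevalleyRowN4883
  Summit.BirchSwinnertonDyer.BirchSwinnertonDyer.Theorems.AlignedTransportAtTwoCubicChevalleyRowN4883ClassNumber

/-! ## §1 The prime seeds `3371`, `3547` (`d ≡ 3 (mod 8)`): `e_n(ℚ(W[2])) = 0` for every `n` -/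

/-- The resolvent tower of `N3371` is `2`-class-number free: `rank₂ Cl(ℚ(√−3371)_n) = 2^{min(n, 0)} − 1 = 0` (`3371` prime, `3371² − 1 = 2³·1420455`), hence `e_n = 0`.
[cite: Ferrero1980AJM, §2] [cite: Washington1997, §13.1] -/
theorem classNumberPExp_resolvent_n3371_eq_zero
    [((⟨1, 0, 1, 0, -3⟩ : WeierstrassCurve ℤ).baseChange ℚ).IsElliptic]
    (κk : ZpExtension ↥ℚ⟮4 * delta ((⟨1, 0, 1, 0, -3⟩ : WeierstrassCurve ℤ).baseChange ℚ) two_ne_zero⟯ 2) (hκk : κk.IsCyclotomic) (n : ℕ) :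
    classNumberPExp κk n = 0 := by
  haveI : FiniteDimensional ℚ ↥ℚ⟮4 * delta ((⟨1, 0, 1, 0, -3⟩ : WeierstrassCurve ℤ).baseChange ℚ) two_ne_zero⟯ :=
    IntermediateField.adjoin.finiteDimensional ((AlgebraicClosure.isAlgebraic ℚ).isAlgebraic _).isIntegral
  haveI : NumberField ↥ℚ⟮4 * delta ((⟨1, 0, 1, 0, -3⟩ : WeierstrassCurve ℤ).baseChange ℚ) two_ne_zero⟯ := NumberField.mk
  apply classNumberPExp_eq_zero_of_classGroupPRank_eq_zero
  have hΔ : ((⟨1, 0, 1, 0, -3⟩ : WeierstrassCurve ℤ).baseChange ℚ).Δ = -((3371 : ℕ) : ℚ) * (1 : ℚ) ^ 2 := by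
    rw [baseChange_int_Δ, M3371_Δ]; norm_num
  have h := classGroupPRank_resolvent_eq_sum ((⟨1, 0, 1, 0, -3⟩ : WeierstrassCurve ℤ).baseChange ℚ)
    (by norm_num : Nat.Prime 3371).squarefree (by norm_num) one_ne_zero hΔ (delta_mem_and_sq _).2 κk hκk n
  rw [h, Nat.Prime.primeFactors (by norm_num : Nat.Prime 3371), Finset.sum_singleton]
  have h3 : padicValNat 2 (3371 ^ 2 - 1) = 3 := by
    rw [show (3371 : ℕ) ^ 2 - 1 = 2 ^ 3 * 1420455 by norm_num, padicValNat.mul (by norm_num) (by norm_num), padicValNat.prime_pow,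
      padicValNat.eq_zero_of_not_dvd (by norm_num)]
  rw [h3]
  simp

/-- ★★★ **`2 ∤ h(ℚ(W[2])_n)` for EVERY layer of EVERY cyclotomic `ℤ₂`-extension of the `S₃`-sextic `ℚ(W[2])`, `W` the odd-branch seed of conductor `3371`**
(`e_n = 0`: `λ₂ = μ₂ = ν₂ = 0`), UNCONDITIONAL: part 2's `S₃` norm-relation descent fed with `e_n(ℚ(β_j)) = 0` (att-p4 g28: `h(ℚ(β)) = 1` kernel, Chevalley,
Fukuda — at each of the three roots) and `e_n(ℚ(√−3371)) = 0` (att-p3 g30: genus theory in `ℚ_n`). [cite: BiasseEtAl2022, Prop. 3.7] [cite: Fukuda1994, Thm. 1 (1), p. 264]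
[cite: Ferrero1980AJM, §2] [cite: LMFDB, number field 3.1.3371.1] -/
theorem classNumberPExp_divisionField_two_n3371_eq_zero
    [((⟨1, 0, 1, 0, -3⟩ : WeierstrassCurve ℤ).baseChange ℚ).IsElliptic]
    (κT : ZpExtension (((⟨1, 0, 1, 0, -3⟩ : WeierstrassCurve ℤ).baseChange ℚ).divisionField 2) 2) (hκT : κT.IsCyclotomic) (n : ℕ) :
    classNumberPExp κT n = 0 := by
  refine classNumberPExp_divisionField_two_eq_zero_of_cubic_of_resolvent _ not_hasRationalTwoTorsionX_n3371 Δ_n3371_neg ?_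
    (classNumberPExp_resolvent_n3371_eq_zero) κT hκT n
  intro j κj hκj m
  have hβ : aeval (xT ((⟨1, 0, 1, 0, -3⟩ : WeierstrassCurve ℤ).baseChange ℚ) two_ne_zero j)
      ((⟨1, 0, 1, 0, -3⟩ : WeierstrassCurve ℤ).baseChange ℚ).twoTorsionPolynomial.toPoly = 0 :=
    (mem_rootSet_of_ne (twoTorsionPolynomial_toPoly_ne_zero _ two_ne_zero)).mp (xT_mem_rootSet _ two_ne_zero j)
  exact classNumberPExp_cubicField_n3371_eq_zero hβ κj hκj m

/-- **`μ₂ = 0` for every cyclotomic `ℤ₂`-extension of `ℚ(W[2])`, `W` the odd-branch seed of conductor `3371`**, unconditional (growth form; from `e_n = 0`).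
[cite: RaySujatha2021, §1 eq. (1.1)] -/
theorem classicalMuVanishes_divisionField_two_n3371
    [((⟨1, 0, 1, 0, -3⟩ : WeierstrassCurve ℤ).baseChange ℚ).IsElliptic]
    (κT : ZpExtension (((⟨1, 0, 1, 0, -3⟩ : WeierstrassCurve ℤ).baseChange ℚ).divisionField 2) 2) (hκT : κT.IsCyclotomic) : ClassicalMuVanishes κT :=
  classicalMuVanishes_of_eventually_const κT (c := 0) (n₀ := 0) fun n _ => classNumberPExp_divisionField_two_n3371_eq_zero κT hκT n

/-- The resolvent tower of `N3547` is `2`-class-number free: `rank₂ Cl(ℚ(√−3547)_n) = 2^{min(n, 0)} − 1 = 0` (`3547` prime, `3547² − 1 = 2³·1572651`), hence `e_n = 0`.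
[cite: Ferrero1980AJM, §2] [cite: Washington1997, §13.1] -/
theorem classNumberPExp_resolvent_n3547_eq_zero
    [((⟨1, -1, 0, 4, -1⟩ : WeierstrassCurve ℤ).baseChange ℚ).IsElliptic]
    (κk : ZpExtension ↥ℚ⟮4 * delta ((⟨1, -1, 0, 4, -1⟩ : WeierstrassCurve ℤ).baseChange ℚ) two_ne_zero⟯ 2) (hκk : κk.IsCyclotomic) (n : ℕ) :
    classNumberPExp κk n = 0 := by
  haveI : FiniteDimensional ℚ ↥ℚ⟮4 * delta ((⟨1, -1, 0, 4, -1⟩ : WeierstrassCurve ℤ).baseChange ℚ) two_ne_zero⟯ :=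
    IntermediateField.adjoin.finiteDimensional ((AlgebraicClosure.isAlgebraic ℚ).isAlgebraic _).isIntegral
  haveI : NumberField ↥ℚ⟮4 * delta ((⟨1, -1, 0, 4, -1⟩ : WeierstrassCurve ℤ).baseChange ℚ) two_ne_zero⟯ := NumberField.mk
  apply classNumberPExp_eq_zero_of_classGroupPRank_eq_zero
  have hΔ : ((⟨1, -1, 0, 4, -1⟩ : WeierstrassCurve ℤ).baseChange ℚ).Δ = -((3547 : ℕ) : ℚ) * (1 : ℚ) ^ 2 := by
    rw [baseChange_int_Δ, M3547_Δ]; norm_num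
  have h := classGroupPRank_resolvent_eq_sum ((⟨1, -1, 0, 4, -1⟩ : WeierstrassCurve ℤ).baseChange ℚ)
    (by norm_num : Nat.Prime 3547).squarefree (by norm_num) one_ne_zero hΔ (delta_mem_and_sq _).2 κk hκk n
  rw [h, Nat.Prime.primeFactors (by norm_num : Nat.Prime 3547), Finset.sum_singleton]
  have h3 : padicValNat 2 (3547 ^ 2 - 1) = 3 := by
    rw [show (3547 : ℕ) ^ 2 - 1 = 2 ^ 3 * 1572651 by norm_num, padicValNat.mul (by norm_num) (by norm_num), padicValNat.prime_pow,
      padicValNat.eq_zero_of_not_dvd (by norm_num)]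
  rw [h3]
  simp

/-- ★★★ **`2 ∤ h(ℚ(W[2])_n)` for EVERY layer of EVERY cyclotomic `ℤ₂`-extension of the `S₃`-sextic `ℚ(W[2])`, `W` the odd-branch seed of conductor `3547`**
(`e_n = 0`: `λ₂ = μ₂ = ν₂ = 0`), UNCONDITIONAL: part 2's `S₃` norm-relation descent fed with `e_n(ℚ(β_j)) = 0` (att-p4 g28: `h(ℚ(β)) = 1` kernel, Chevalley,
Fukuda — at each of the three roots) and `e_n(ℚ(√−3547)) = 0` (att-p3 g30: genus theory in `ℚ_n`). [cite: BiasseEtAl2022, Prop. 3.7] [cite: Fukuda1994, Thm. 1 (1), p. 264]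
[cite: Ferrero1980AJM, §2] [cite: LMFDB, number field 3.1.3547.1] -/
theorem classNumberPExp_divisionField_two_n3547_eq_zero
    [((⟨1, -1, 0, 4, -1⟩ : WeierstrassCurve ℤ).baseChange ℚ).IsElliptic]
    (κT : ZpExtension (((⟨1, -1, 0, 4, -1⟩ : WeierstrassCurve ℤ).baseChange ℚ).divisionField 2) 2) (hκT : κT.IsCyclotomic) (n : ℕ) :
    classNumberPExp κT n = 0 := by
  refine classNumberPExp_divisionField_two_eq_zero_of_cubic_of_resolvent _ not_hasRationalTwoTorsionX_n3547 Δ_n3547_neg ?_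
    (classNumberPExp_resolvent_n3547_eq_zero) κT hκT n
  intro j κj hκj m
  have hβ : aeval (xT ((⟨1, -1, 0, 4, -1⟩ : WeierstrassCurve ℤ).baseChange ℚ) two_ne_zero j)
      ((⟨1, -1, 0, 4, -1⟩ : WeierstrassCurve ℤ).baseChange ℚ).twoTorsionPolynomial.toPoly = 0 :=
    (mem_rootSet_of_ne (twoTorsionPolynomial_toPoly_ne_zero _ two_ne_zero)).mp (xT_mem_rootSet _ two_ne_zero j)
  exact classNumberPExp_cubicField_n3547_eq_zero hβ κj hκj m

/-- **`μ₂ = 0` for every cyclotomic `ℤ₂`-extension of `ℚ(W[2])`, `W` the odd-branch seed of conductor `3547`**, unconditional (growth form; from `e_n = 0`).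
[cite: RaySujatha2021, §1 eq. (1.1)] -/
theorem classicalMuVanishes_divisionField_two_n3547
    [((⟨1, -1, 0, 4, -1⟩ : WeierstrassCurve ℤ).baseChange ℚ).IsElliptic]
    (κT : ZpExtension (((⟨1, -1, 0, 4, -1⟩ : WeierstrassCurve ℤ).baseChange ℚ).divisionField 2) 2) (hκT : κT.IsCyclotomic) : ClassicalMuVanishes κT :=
  classicalMuVanishes_of_eventually_const κT (c := 0) (n₀ := 0) fun n _ => classNumberPExp_divisionField_two_n3547_eq_zero κT hκT n

/-! ## §2 The composite seeds `1763`, `2515`, `3115`, `4771`, `4883`: `μ₂(ℚ(W[2])^{cyc}) = 0` -/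

/-- **`μ₂(ℚ(√−1763)) = 0` for every cyclotomic `ℤ₂`-extension of the resolvent `ℚ(δ) = ℚ(√−1763)` of the odd-branch seed of conductor `1763 = 41·43`**,
UNCONDITIONAL (att-p3 g30's Ferrero–Kida upper half / Fukuda stabilisation; the resolvent has `rank₂ Cl_n ≥ 1`, so `e_n ≠ 0` here).
[cite: Ferrero1980AJM, Thm.] [cite: Fukuda1994, Thm. 1 (2), p. 264] -/
theorem classicalMuVanishes_resolvent_n1763
    [((⟨1, 0, 1, -3, -3⟩ : WeierstrassCurve ℤ).baseChange ℚ).IsElliptic]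
    (κk : ZpExtension ↥ℚ⟮4 * delta ((⟨1, 0, 1, -3, -3⟩ : WeierstrassCurve ℤ).baseChange ℚ) two_ne_zero⟯ 2) (hκk : κk.IsCyclotomic) : ClassicalMuVanishes κk := by
  have hΔ : ((⟨1, 0, 1, -3, -3⟩ : WeierstrassCurve ℤ).baseChange ℚ).Δ = -((1763 : ℕ) : ℚ) * (1 : ℚ) ^ 2 := by
    rw [baseChange_int_Δ, M1763_Δ]; norm_num
  have hd : Squarefree (1763 : ℕ) := by
    rw [show (1763 : ℕ) = 41 * 43 by norm_num]
    exact (Nat.squarefree_mul (by norm_num)).mpr ⟨(Nat.prime_iff.mp (by norm_num)).squarefree, (Nat.prime_iff.mp (by norm_num)).squarefree⟩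
  exact (classicalLambda_resolvent_le ((⟨1, 0, 1, -3, -3⟩ : WeierstrassCurve ℤ).baseChange ℚ) hd (by norm_num) one_ne_zero hΔ (delta_mem_and_sq _).2 κk hκk).1

/-- ★★ **`μ₂ = 0` for EVERY cyclotomic `ℤ₂`-extension of the `S₃`-sextic `ℚ(W[2])`, `W` the odd-branch seed of conductor `1763 = 41·43`**, UNCONDITIONAL:
part 2's `μ`-form of the `S₃` norm-relation descent fed with att-p4 g28's `classicalMuVanishes_cubicField_n1763` (`h(ℚ(β)) = 1` kernel, Chevalley, Fukuda — at each of
the three roots, no hypothesis) and `classicalMuVanishes_resolvent_n1763`. [cite: BiasseEtAl2022, Prop. 3.7] [cite: Washington1997, §13.1] [cite: RaySujatha2021, §1 eq. (1.1)]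
[cite: LMFDB, number field 3.1.1763.1] -/
theorem classicalMuVanishes_divisionField_two_n1763
    [((⟨1, 0, 1, -3, -3⟩ : WeierstrassCurve ℤ).baseChange ℚ).IsElliptic]
    (κT : ZpExtension (((⟨1, 0, 1, -3, -3⟩ : WeierstrassCurve ℤ).baseChange ℚ).divisionField 2) 2) (hκT : κT.IsCyclotomic) : ClassicalMuVanishes κT := by
  refine classicalMuVanishes_divisionField_two_of_cubic_of_resolvent _ not_hasRationalTwoTorsionX_n1763 Δ_n1763_neg ?_
    (classicalMuVanishes_resolvent_n1763) κT hκT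
  intro j κj hκj
  have hβ : aeval (xT ((⟨1, 0, 1, -3, -3⟩ : WeierstrassCurve ℤ).baseChange ℚ) two_ne_zero j)
      ((⟨1, 0, 1, -3, -3⟩ : WeierstrassCurve ℤ).baseChange ℚ).twoTorsionPolynomial.toPoly = 0 :=
    (mem_rootSet_of_ne (twoTorsionPolynomial_toPoly_ne_zero _ two_ne_zero)).mp (xT_mem_rootSet _ two_ne_zero j)
  exact classicalMuVanishes_cubicField_n1763 hβ κj hκj

/-- **`μ₂(ℚ(√−2515)) = 0` for every cyclotomic `ℤ₂`-extension of the resolvent `ℚ(δ) = ℚ(√−2515)` of the odd-branch seed of conductor `2515 = 5·503`**,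
UNCONDITIONAL (att-p3 g30's Ferrero–Kida upper half / Fukuda stabilisation; the resolvent has `rank₂ Cl_n ≥ 1`, so `e_n ≠ 0` here).
[cite: Ferrero1980AJM, Thm.] [cite: Fukuda1994, Thm. 1 (2), p. 264] -/
theorem classicalMuVanishes_resolvent_n2515
    [((⟨1, 1, 0, 2, 3⟩ : WeierstrassCurve ℤ).baseChange ℚ).IsElliptic]
    (κk : ZpExtension ↥ℚ⟮4 * delta ((⟨1, 1, 0, 2, 3⟩ : WeierstrassCurve ℤ).baseChange ℚ) two_ne_zero⟯ 2) (hκk : κk.IsCyclotomic) : ClassicalMuVanishes κk := by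
  have hΔ : ((⟨1, 1, 0, 2, 3⟩ : WeierstrassCurve ℤ).baseChange ℚ).Δ = -((2515 : ℕ) : ℚ) * (1 : ℚ) ^ 2 := by
    rw [baseChange_int_Δ, M2515_Δ]; norm_num
  have hd : Squarefree (2515 : ℕ) := by
    rw [show (2515 : ℕ) = 5 * 503 by norm_num]
    exact (Nat.squarefree_mul (by norm_num)).mpr ⟨(Nat.prime_iff.mp (by norm_num)).squarefree, (Nat.prime_iff.mp (by norm_num)).squarefree⟩
  exact (classicalLambda_resolvent_le ((⟨1, 1, 0, 2, 3⟩ : WeierstrassCurve ℤ).baseChange ℚ) hd (by norm_num) one_ne_zero hΔ (delta_mem_and_sq _).2 κk hκk).1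

/-- ★★ **`μ₂ = 0` for EVERY cyclotomic `ℤ₂`-extension of the `S₃`-sextic `ℚ(W[2])`, `W` the odd-branch seed of conductor `2515 = 5·503`**, UNCONDITIONAL:
part 2's `μ`-form of the `S₃` norm-relation descent fed with att-p4 g28's `classicalMuVanishes_cubicField_n2515` (`h(ℚ(β)) = 1` kernel, Chevalley, Fukuda — at each of
the three roots, no hypothesis) and `classicalMuVanishes_resolvent_n2515`. [cite: BiasseEtAl2022, Prop. 3.7] [cite: Washington1997, §13.1] [cite: RaySujatha2021, §1 eq. (1.1)]
[cite: LMFDB, number field 3.1.2515.1] -/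
theorem classicalMuVanishes_divisionField_two_n2515
    [((⟨1, 1, 0, 2, 3⟩ : WeierstrassCurve ℤ).baseChange ℚ).IsElliptic]
    (κT : ZpExtension (((⟨1, 1, 0, 2, 3⟩ : WeierstrassCurve ℤ).baseChange ℚ).divisionField 2) 2) (hκT : κT.IsCyclotomic) : ClassicalMuVanishes κT := by
  refine classicalMuVanishes_divisionField_two_of_cubic_of_resolvent _ not_hasRationalTwoTorsionX_n2515 Δ_n2515_neg ?_
    (classicalMuVanishes_resolvent_n2515) κT hκT
  intro j κj hκj
  have hβ : aeval (xT ((⟨1, 1, 0, 2, 3⟩ : WeierstrassCurve ℤ).baseChange ℚ) two_ne_zero j)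
      ((⟨1, 1, 0, 2, 3⟩ : WeierstrassCurve ℤ).baseChange ℚ).twoTorsionPolynomial.toPoly = 0 :=
    (mem_rootSet_of_ne (twoTorsionPolynomial_toPoly_ne_zero _ two_ne_zero)).mp (xT_mem_rootSet _ two_ne_zero j)
  exact classicalMuVanishes_cubicField_n2515 hβ κj hκj

/-- **`μ₂(ℚ(√−3115)) = 0` for every cyclotomic `ℤ₂`-extension of the resolvent `ℚ(δ) = ℚ(√−3115)` of the odd-branch seed of conductor `3115 = 5·7·89`**,
UNCONDITIONAL (att-p3 g30's Ferrero–Kida upper half / Fukuda stabilisation; the resolvent has `rank₂ Cl_n ≥ 1`, so `e_n ≠ 0` here).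
[cite: Ferrero1980AJM, Thm.] [cite: Fukuda1994, Thm. 1 (2), p. 264] -/
theorem classicalMuVanishes_resolvent_n3115
    [((⟨1, -1, 0, -5, -4⟩ : WeierstrassCurve ℤ).baseChange ℚ).IsElliptic]
    (κk : ZpExtension ↥ℚ⟮4 * delta ((⟨1, -1, 0, -5, -4⟩ : WeierstrassCurve ℤ).baseChange ℚ) two_ne_zero⟯ 2) (hκk : κk.IsCyclotomic) : ClassicalMuVanishes κk := by
  have hΔ : ((⟨1, -1, 0, -5, -4⟩ : WeierstrassCurve ℤ).baseChange ℚ).Δ = -((3115 : ℕ) : ℚ) * (1 : ℚ) ^ 2 := by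
    rw [baseChange_int_Δ, M3115_Δ]; norm_num
  have hd : Squarefree (3115 : ℕ) := by
    rw [show (3115 : ℕ) = (5 * 7) * 89 by norm_num]
    exact (Nat.squarefree_mul (by norm_num)).mpr ⟨(Nat.squarefree_mul (by norm_num)).mpr
      ⟨(Nat.prime_iff.mp (by norm_num)).squarefree, (Nat.prime_iff.mp (by norm_num)).squarefree⟩, (Nat.prime_iff.mp (by norm_num)).squarefree⟩
  exact (classicalLambda_resolvent_le ((⟨1, -1, 0, -5, -4⟩ : WeierstrassCurve ℤ).baseChange ℚ) hd (by norm_num) one_ne_zero hΔ (delta_mem_and_sq _).2 κk hκk).1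

/-- ★★ **`μ₂ = 0` for EVERY cyclotomic `ℤ₂`-extension of the `S₃`-sextic `ℚ(W[2])`, `W` the odd-branch seed of conductor `3115 = 5·7·89`**, UNCONDITIONAL:
part 2's `μ`-form of the `S₃` norm-relation descent fed with att-p4 g28's `classicalMuVanishes_cubicField_n3115` (`h(ℚ(β)) = 1` kernel, Chevalley, Fukuda — at each of
the three roots, no hypothesis) and `classicalMuVanishes_resolvent_n3115`. [cite: BiasseEtAl2022, Prop. 3.7] [cite: Washington1997, §13.1] [cite: RaySujatha2021, §1 eq. (1.1)]
[cite: LMFDB, number field 3.1.3115.1] -/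
theorem classicalMuVanishes_divisionField_two_n3115
    [((⟨1, -1, 0, -5, -4⟩ : WeierstrassCurve ℤ).baseChange ℚ).IsElliptic]
    (κT : ZpExtension (((⟨1, -1, 0, -5, -4⟩ : WeierstrassCurve ℤ).baseChange ℚ).divisionField 2) 2) (hκT : κT.IsCyclotomic) : ClassicalMuVanishes κT := by
  refine classicalMuVanishes_divisionField_two_of_cubic_of_resolvent _ not_hasRationalTwoTorsionX_n3115 Δ_n3115_neg ?_
    (classicalMuVanishes_resolvent_n3115) κT hκT
  intro j κj hκj
  have hβ : aeval (xT ((⟨1, -1, 0, -5, -4⟩ : WeierstrassCurve ℤ).baseChange ℚ) two_ne_zero j)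
      ((⟨1, -1, 0, -5, -4⟩ : WeierstrassCurve ℤ).baseChange ℚ).twoTorsionPolynomial.toPoly = 0 :=
    (mem_rootSet_of_ne (twoTorsionPolynomial_toPoly_ne_zero _ two_ne_zero)).mp (xT_mem_rootSet _ two_ne_zero j)
  exact classicalMuVanishes_cubicField_n3115 hβ κj hκj

/-- **`μ₂(ℚ(√−4771)) = 0` for every cyclotomic `ℤ₂`-extension of the resolvent `ℚ(δ) = ℚ(√−4771)` of the odd-branch seed of conductor `4771 = 13·367`**,
UNCONDITIONAL (att-p3 g30's Ferrero–Kida upper half / Fukuda stabilisation; the resolvent has `rank₂ Cl_n ≥ 1`, so `e_n ≠ 0` here).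
[cite: Ferrero1980AJM, Thm.] [cite: Fukuda1994, Thm. 1 (2), p. 264] -/
theorem classicalMuVanishes_resolvent_n4771
    [((⟨1, -1, 0, -11, -12⟩ : WeierstrassCurve ℤ).baseChange ℚ).IsElliptic]
    (κk : ZpExtension ↥ℚ⟮4 * delta ((⟨1, -1, 0, -11, -12⟩ : WeierstrassCurve ℤ).baseChange ℚ) two_ne_zero⟯ 2) (hκk : κk.IsCyclotomic) : ClassicalMuVanishes κk := by
  have hΔ : ((⟨1, -1, 0, -11, -12⟩ : WeierstrassCurve ℤ).baseChange ℚ).Δ = -((4771 : ℕ) : ℚ) * (1 : ℚ) ^ 2 := by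
    rw [baseChange_int_Δ, M4771_Δ]; norm_num
  have hd : Squarefree (4771 : ℕ) := by
    rw [show (4771 : ℕ) = 13 * 367 by norm_num]
    exact (Nat.squarefree_mul (by norm_num)).mpr ⟨(Nat.prime_iff.mp (by norm_num)).squarefree, (Nat.prime_iff.mp (by norm_num)).squarefree⟩
  exact (classicalLambda_resolvent_le ((⟨1, -1, 0, -11, -12⟩ : WeierstrassCurve ℤ).baseChange ℚ) hd (by norm_num) one_ne_zero hΔ (delta_mem_and_sq _).2 κk hκk).1

/-- ★★ **`μ₂ = 0` for EVERY cyclotomic `ℤ₂`-extension of the `S₃`-sextic `ℚ(W[2])`, `W` the odd-branch seed of conductor `4771 = 13·367`**, UNCONDITIONAL: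
part 2's `μ`-form of the `S₃` norm-relation descent fed with att-p4 g28's `classicalMuVanishes_cubicField_n4771` (`h(ℚ(β)) = 1` kernel, Chevalley, Fukuda — at each of
the three roots, no hypothesis) and `classicalMuVanishes_resolvent_n4771`. [cite: BiasseEtAl2022, Prop. 3.7] [cite: Washington1997, §13.1] [cite: RaySujatha2021, §1 eq. (1.1)]
[cite: LMFDB, number field 3.1.4771.1] -/
theorem classicalMuVanishes_divisionField_two_n4771
    [((⟨1, -1, 0, -11, -12⟩ : WeierstrassCurve ℤ).baseChange ℚ).IsElliptic]
    (κT : ZpExtension (((⟨1, -1, 0, -11, -12⟩ : WeierstrassCurve ℤ).baseChange ℚ).divisionField 2) 2) (hκT : κT.IsCyclotomic) : ClassicalMuVanishes κT := by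
  refine classicalMuVanishes_divisionField_two_of_cubic_of_resolvent _ not_hasRationalTwoTorsionX_n4771 Δ_n4771_neg ?_
    (classicalMuVanishes_resolvent_n4771) κT hκT
  intro j κj hκj
  have hβ : aeval (xT ((⟨1, -1, 0, -11, -12⟩ : WeierstrassCurve ℤ).baseChange ℚ) two_ne_zero j)
      ((⟨1, -1, 0, -11, -12⟩ : WeierstrassCurve ℤ).baseChange ℚ).twoTorsionPolynomial.toPoly = 0 :=
    (mem_rootSet_of_ne (twoTorsionPolynomial_toPoly_ne_zero _ two_ne_zero)).mp (xT_mem_rootSet _ two_ne_zero j)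
  exact classicalMuVanishes_cubicField_n4771 hβ κj hκj

/-- **`μ₂(ℚ(√−4883)) = 0` for every cyclotomic `ℤ₂`-extension of the resolvent `ℚ(δ) = ℚ(√−4883)` of the odd-branch seed of conductor `4883 = 19·257`**,
UNCONDITIONAL (att-p3 g30's Ferrero–Kida upper half / Fukuda stabilisation; the resolvent has `rank₂ Cl_n ≥ 1`, so `e_n ≠ 0` here).
[cite: Ferrero1980AJM, Thm.] [cite: Fukuda1994, Thm. 1 (2), p. 264] -/
theorem classicalMuVanishes_resolvent_n4883
    [((⟨1, 1, 0, -1, -4⟩ : WeierstrassCurve ℤ).baseChange ℚ).IsElliptic]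
    (κk : ZpExtension ↥ℚ⟮4 * delta ((⟨1, 1, 0, -1, -4⟩ : WeierstrassCurve ℤ).baseChange ℚ) two_ne_zero⟯ 2) (hκk : κk.IsCyclotomic) : ClassicalMuVanishes κk := by
  have hΔ : ((⟨1, 1, 0, -1, -4⟩ : WeierstrassCurve ℤ).baseChange ℚ).Δ = -((4883 : ℕ) : ℚ) * (1 : ℚ) ^ 2 := by
    rw [baseChange_int_Δ, M4883_Δ]; norm_num
  have hd : Squarefree (4883 : ℕ) := by
    rw [show (4883 : ℕ) = 19 * 257 by norm_num]
    exact (Nat.squarefree_mul (by norm_num)).mpr ⟨(Nat.prime_iff.mp (by norm_num)).squarefree, (Nat.prime_iff.mp (by norm_num)).squarefree⟩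
  exact (classicalLambda_resolvent_le ((⟨1, 1, 0, -1, -4⟩ : WeierstrassCurve ℤ).baseChange ℚ) hd (by norm_num) one_ne_zero hΔ (delta_mem_and_sq _).2 κk hκk).1

/-- ★★ **`μ₂ = 0` for EVERY cyclotomic `ℤ₂`-extension of the `S₃`-sextic `ℚ(W[2])`, `W` the odd-branch seed of conductor `4883 = 19·257`**, UNCONDITIONAL:
part 2's `μ`-form of the `S₃` norm-relation descent fed with att-p4 g28's `classicalMuVanishes_cubicField_n4883` (`h(ℚ(β)) = 1` kernel, Chevalley, Fukuda — at each of
the three roots, no hypothesis) and `classicalMuVanishes_resolvent_n4883`. [cite: BiasseEtAl2022, Prop. 3.7] [cite: Washington1997, §13.1] [cite: RaySujatha2021, §1 eq. (1.1)]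
[cite: LMFDB, number field 3.1.4883.1] -/
theorem classicalMuVanishes_divisionField_two_n4883
    [((⟨1, 1, 0, -1, -4⟩ : WeierstrassCurve ℤ).baseChange ℚ).IsElliptic]
    (κT : ZpExtension (((⟨1, 1, 0, -1, -4⟩ : WeierstrassCurve ℤ).baseChange ℚ).divisionField 2) 2) (hκT : κT.IsCyclotomic) : ClassicalMuVanishes κT := by
  refine classicalMuVanishes_divisionField_two_of_cubic_of_resolvent _ not_hasRationalTwoTorsionX_n4883 Δ_n4883_neg ?_
    (classicalMuVanishes_resolvent_n4883) κT hκT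
  intro j κj hκj
  have hβ : aeval (xT ((⟨1, 1, 0, -1, -4⟩ : WeierstrassCurve ℤ).baseChange ℚ) two_ne_zero j)
      ((⟨1, 1, 0, -1, -4⟩ : WeierstrassCurve ℤ).baseChange ℚ).twoTorsionPolynomial.toPoly = 0 :=
    (mem_rootSet_of_ne (twoTorsionPolynomial_toPoly_ne_zero _ two_ne_zero)).mp (xT_mem_rootSet _ two_ne_zero j)
  exact classicalMuVanishes_cubicField_n4883 hβ κj hκj

end Summit.BirchSwinnertonDyer.BirchSwinnertonDyer.Theorems.AlignedTransportAtTwoSexticNormRelationDescentSeedsB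

end
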